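import Summits.Ventures.CertifiedManyBodySolver.Observables.PhaseSeparationExclusionBoxThermal
import Summits.Ventures.CertifiedManyBodySolver.Downfold.BoxesLa214V115M2cPhaseSeparationDilute
import Mathlib.Analysis.Complex.ExponentialBounds
import HarnessLib

/-!
# Ventures/CertifiedManyBodySolver — Downfold/BoxesLa214V115M2cPhaseSeparationThermal.lean

HONEST FRAMING: the `T > 0` reading of the «competing orders» cells of `Downfold/BoxesLa214V115M2cPhaseSeparation{,Dilute}.lean` on the
La₂₋ₓSrₓCuO₄ `x = 1/8` one-band box (`t′/t ∈ [−3/10, −1/5]`, filling `7/8`): EXCLUSION of macroscopic coexistence of the half-filled (or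
denser) phase with a DILUTE phase (density `≤ 1/5`, resp. `≤ 1/4`) in every CANONICAL THERMAL torus-limit state (sector Gibbs state, any
sector density) at inverse temperatures `β ≥ β₀` — CONTROL class; conditional BY NAME on the same claim nodes as the parents (VARBOX plane
`cert_obx32x4tpm1o4D1200_openbox_32x4_N112_planes`; K2DIAG-A bootstraps `cert_laBoxE_K2diag_GU29o5n1tpm3o10_j295889_up`,
`cert_laBoxE_K2diag_GU8n1tpm3o10_j299783_up`; registry #21 · #487 · #427 · #488 · #472 · #428); the entropy allowance is the crude `log 4`
per site; nothing about stripes, about coexistence with a phase of hole doping `≲ 0.75`, about superconductivity or `T_c`; nothing about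
La₁.₈₇₅Sr₀.₁₂₅CuO₄; no number of record. Zero compute.

Cell `pub/hubbard-downfold` (MO-S1 ↔ S2 seam; D-0096 (ii)+(iii)), seat `hubbard-downfold-unc-2` (`prover-hubbard-downfold-unc-2-g19-0`).
Instrument: `Observables/PhaseSeparationExclusionBoxThermal.lean` (column forms; law `not_isTorusLimitOfMixture_mix_of_energyWindows_of_le`:
a `T = 0` margin `M` is a `T > 0` exclusion for `β > 2 log 2 / M`). Inputs: the parents' cap plane / `n = 1` column laws / dilute
`t′`-chord floors (rows touching at `1/4`). THE CELLS (`T = 0` column margins `≥ m` exact; `β₀·m > 2 log 2 = 1.3862944`; temperature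
readings with the box's `t ∈ [0.34, 0.40]` eV [float, S1 box]):
* §1 `lsco78_not_thermal_mix_le_1o5_ge_one_beta40` — `(≤ 1/5 | ≥ 1)` coexistence EXCLUDED on `t′ ∈ [−3/10, −1/5] × U ∈ [79/10, 81/10]` for every
  `β ≥ 40` (`m = 0.0348`; `T ≲ 99–116 K`);
* §2 `lsco78_not_thermal_mix_le_1o4_ge_one_beta77` — `(≤ 1/4 | ≥ 1)` on `U ∈ [79/10, 81/10]` for every `β ≥ 77` (`m = 0.0182`; `T ≲ 51–60 K`);
  (also certifiable, not typed: `(≤ 1/5 | ≥ 1)` on `U ∈ [77/10, 83/10]` for `β ≥ 55`, `m = 0.0254`).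
READING (D-0098 cell annotation, CONTROL): «LSCO x = 1/8 one-band box, cells t′/t ∈ [−0.30, −0.20] × U/t ≈ 8 ± 0.1: at T ≲ 100 K no
macroscopic phase separation of the thermal state into the half-filled (or denser) phase and a phase of hole doping ≥ 80 %».
WHAT THIS IS NOT: a certificate; a statement at other `U`, other `β`, or about La₁.₈₇₅Sr₀.₁₂₅CuO₄; a stripe / superconductivity / `T_c` sentence.
References: R. B. Israel, *Convexity in the Theory of Lattice Gases* (1979) Thm I.2.4 [Israel1979]; D. Ruelle, *Statistical Mechanics* (1969)
§3.3 [Ruelle1969]; V. J. Emery, S. A. Kivelson, H. Q. Lin, PRL 64 (1990) 475 [EmeryKivelsonLin1990].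
-/

noncomputable section

namespace Summit.Ventures.CertifiedManyBodySolver.Downfold

open Summit.Ventures.CertifiedManyBodySolver.Observables
open Summit.Ventures.CertifiedManyBodySolver.Certificates
open Literature.MathematicalPhysics.QuantumLattice Literature.MathematicalPhysics.QuantumLattice.ThermodynamicLimit
open Literature.MathematicalPhysics.QuantumLattice.InfVolFermionState Set Filter

/-- `2·log 2 < β·m` once `β ≥ β₀` and `β₀·m > 1.3862944` (`log 2 < 0.6931471808`). [folklore] -/
theorem two_log_two_lt_mul_of_le {β β₀ m : ℝ} (hm : 0 ≤ m) (hβ : β₀ ≤ β) (h0 : (1.3862943616 : ℝ) ≤ β₀ * m) :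
    2 * Real.log 2 < β * m := by
  have hl := Real.log_two_lt_d9
  have k := mul_le_mul_of_nonneg_right hβ hm
  linarith

/-! ## §1 `(≤ 1/5 | ≥ 1)` coexistence EXCLUDED in thermal states on `t′ ∈ [−3/10, −1/5] × U ∈ [79/10, 81/10]`, every `β ≥ 40` -/

/-- **Left `t′`-half, columns `[79 / 10, 8]`, `n₁ = 1 / 5`, `β ≥ 40`** (column margins `≥ 0.0348`). [cite: Israel1979, Thm. I.2.4] [cite: Ruelle1969, §3.3] -/
theorem lsco78_psT_1o5_beta40_left_columns (hVB : cert_obx32x4tpm1o4D1200_openbox_32x4_N112_planes)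
    (hK29 : cert_laBoxE_K2diag_GU29o5n1tpm3o10_j295889_up) (hK8 : cert_laBoxE_K2diag_GU8n1tpm3o10_j299783_up)
    (h21 : cert_r21_luc_tl_upper_n1_U6) (h487 : cert_r487_hubSQ_hanK7R6_U10_r5_e4_so4blk)
    (h427 : cert_r427_hubSQ_hanK7_U5_r5_e4_so4blk) (h488 : cert_r488_hubSQ_hanK7R6_U6_r5_e4_so4blk)
    (h472 : cert_r472_pb2_tl_upper_n1_U8) (h428 : cert_r428_hubSQ_hanK7R6_U8_r5_e4_so4blk)
    {s : ℝ} (hs : s ∈ Icc (-3 / 10 : ℝ) (-1 / 4)) {U : ℝ} (hU : U ∈ Icc (79 / 10 : ℝ) 8)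
    {β : ℝ} (hβ : (40 : ℝ) ≤ β)
    {ω₁ ω₂ : InfVolFermionState 2} (h₁ : ω₁.IsTranslationInvariant) (h₂ : ω₂.IsTranslationInvariant)
    (hρ₁ : 0 < ω₁.density) (hρ₁' : ω₁.density ≤ 1 / 5) (hρ₂ : 1 ≤ ω₂.density) (hρ₂' : ω₂.density < 2)
    {n : ℝ} (hn0 : 0 < n) (hn2 : n < 2) {lam : ℝ} (hl0 : 0 < lam) (hl1 : lam < 1) {Ls : ℕ → ℕ}
    (hLs : Tendsto Ls atTop atTop) :
    ¬ (mix lam hl0.le hl1.le ω₁ ω₂).IsTorusLimitOfMixture (sectorGibbsCount n) (fun L => sectorGibbsWeightTT' β 1 s U n L)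
      (fun L => sectorGibbsVectorTT' 1 s U n L) Ls := by
  have hβ0 : (0 : ℝ) < β := lt_of_lt_of_le (by norm_num) hβ
  refine psT_not_thermal_mix_on_cell_of_columns 1 (s₁ := -3 / 10) (s₂ := -1 / 4) (U₁ := 79 / 10) (U₂ := 8)
    (n₁ := 1 / 5) (n₂ := 1) (a := 5 / 32) (b := 27 / 32) (m := 0.0348) (by norm_num) (by norm_num) hβ0 (by norm_num) (by norm_num) (by norm_num)
    (by norm_num) (by norm_num) (by norm_num)
    (lsco78_capPlane_on_cell_of hVB (by norm_num) (by norm_num) (by norm_num))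
    (fun s hs => lsco_n1_lawAt_of hK29 hK8 h21 h487 h427 h488 h472 h428 (U₀ := 79 / 10) (by norm_num) s
      ⟨hs.1.trans' (by norm_num), hs.2.trans (by norm_num)⟩)
    (fun s hs => lsco_n1_law8_of hK8 h472 h428 s ⟨hs.1.trans' (by norm_num), hs.2.trans (by norm_num)⟩)
    (fun s hs U hU => lsco_dilute14_floor_left (n₁ := 1 / 5) (by norm_num) (by norm_num) s hs U (by linarith [hU.1]))
    ?_ ?_ (two_log_two_lt_mul_of_le (by norm_num) hβ (by norm_num)) hs hU h₁ h₂ hρ₁ hρ₁' hρ₂ hρ₂' hn0 hn2 hl0 hl1 hLs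
  · intro s hs; obtain ⟨h1, h2⟩ := hs; push_cast; norm_num; nlinarith [h1, h2]
  · intro s hs; obtain ⟨h1, h2⟩ := hs; push_cast; norm_num; nlinarith [h1, h2]

/-- **Left `t′`-half, `U ∈ [8, 81 / 10]`, `n₁ = 1 / 5`, `β ≥ 40`.** [cite: Israel1979, Thm. I.2.4] [cite: Griffiths1966, §II] -/
theorem lsco78_psT_1o5_beta40_left_above (hVB : cert_obx32x4tpm1o4D1200_openbox_32x4_N112_planes)
    (hK8 : cert_laBoxE_K2diag_GU8n1tpm3o10_j299783_up)
    (h472 : cert_r472_pb2_tl_upper_n1_U8) (h428 : cert_r428_hubSQ_hanK7R6_U8_r5_e4_so4blk)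
    {s : ℝ} (hs : s ∈ Icc (-3 / 10 : ℝ) (-1 / 4)) {U : ℝ} (hU : U ∈ Icc (8 : ℝ) (81 / 10))
    {β : ℝ} (hβ : (40 : ℝ) ≤ β)
    {ω₁ ω₂ : InfVolFermionState 2} (h₁ : ω₁.IsTranslationInvariant) (h₂ : ω₂.IsTranslationInvariant)
    (hρ₁ : 0 < ω₁.density) (hρ₁' : ω₁.density ≤ 1 / 5) (hρ₂ : 1 ≤ ω₂.density) (hρ₂' : ω₂.density < 2)
    {n : ℝ} (hn0 : 0 < n) (hn2 : n < 2) {lam : ℝ} (hl0 : 0 < lam) (hl1 : lam < 1) {Ls : ℕ → ℕ}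
    (hLs : Tendsto Ls atTop atTop) :
    ¬ (mix lam hl0.le hl1.le ω₁ ω₂).IsTorusLimitOfMixture (sectorGibbsCount n) (fun L => sectorGibbsWeightTT' β 1 s U n L)
      (fun L => sectorGibbsVectorTT' 1 s U n L) Ls := by
  have hβ0 : (0 : ℝ) < β := lt_of_lt_of_le (by norm_num) hβ
  refine psT_not_thermal_mix_above_column 1 (s₁ := -3 / 10) (s₂ := -1 / 4) (U₂ := 8) (U₃ := 81 / 10)
    (n₁ := 1 / 5) (n₂ := 1) (a := 5 / 32) (b := 27 / 32) (m := 0.0348) (by norm_num) (by norm_num) hβ0 (by norm_num) (by norm_num) (by norm_num)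
    (by norm_num) (by norm_num) (by norm_num)
    (lsco78_capPlane_on_cell_of hVB (by norm_num) (by norm_num) (by norm_num))
    (fun s hs => lsco_n1_law8_of hK8 h472 h428 s ⟨hs.1.trans' (by norm_num), hs.2.trans (by norm_num)⟩)
    (fun s hs U hU => lsco_dilute14_floor_left (n₁ := 1 / 5) (by norm_num) (by norm_num) s hs U (by linarith [hU.1]))
    ?_ (two_log_two_lt_mul_of_le (by norm_num) hβ (by norm_num)) hs hU h₁ h₂ hρ₁ hρ₁' hρ₂ hρ₂' hn0 hn2 hl0 hl1 hLs
  intro s hs; obtain ⟨h1, h2⟩ := hs; push_cast; norm_num; nlinarith [h1, h2]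

/-- **Right `t′`-half, columns `[79 / 10, 8]`, `n₁ = 1 / 5`, `β ≥ 40`.** [cite: Israel1979, Thm. I.2.4] [cite: Ruelle1969, §3.3] -/
theorem lsco78_psT_1o5_beta40_right_columns (hVB : cert_obx32x4tpm1o4D1200_openbox_32x4_N112_planes)
    (hK29 : cert_laBoxE_K2diag_GU29o5n1tpm3o10_j295889_up) (hK8 : cert_laBoxE_K2diag_GU8n1tpm3o10_j299783_up)
    (h21 : cert_r21_luc_tl_upper_n1_U6) (h487 : cert_r487_hubSQ_hanK7R6_U10_r5_e4_so4blk)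
    (h427 : cert_r427_hubSQ_hanK7_U5_r5_e4_so4blk) (h488 : cert_r488_hubSQ_hanK7R6_U6_r5_e4_so4blk)
    (h472 : cert_r472_pb2_tl_upper_n1_U8) (h428 : cert_r428_hubSQ_hanK7R6_U8_r5_e4_so4blk)
    {s : ℝ} (hs : s ∈ Icc (-1 / 4 : ℝ) (-1 / 5)) {U : ℝ} (hU : U ∈ Icc (79 / 10 : ℝ) 8)
    {β : ℝ} (hβ : (40 : ℝ) ≤ β)
    {ω₁ ω₂ : InfVolFermionState 2} (h₁ : ω₁.IsTranslationInvariant) (h₂ : ω₂.IsTranslationInvariant)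
    (hρ₁ : 0 < ω₁.density) (hρ₁' : ω₁.density ≤ 1 / 5) (hρ₂ : 1 ≤ ω₂.density) (hρ₂' : ω₂.density < 2)
    {n : ℝ} (hn0 : 0 < n) (hn2 : n < 2) {lam : ℝ} (hl0 : 0 < lam) (hl1 : lam < 1) {Ls : ℕ → ℕ}
    (hLs : Tendsto Ls atTop atTop) :
    ¬ (mix lam hl0.le hl1.le ω₁ ω₂).IsTorusLimitOfMixture (sectorGibbsCount n) (fun L => sectorGibbsWeightTT' β 1 s U n L)
      (fun L => sectorGibbsVectorTT' 1 s U n L) Ls := by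
  have hβ0 : (0 : ℝ) < β := lt_of_lt_of_le (by norm_num) hβ
  refine psT_not_thermal_mix_on_cell_of_columns 1 (s₁ := -1 / 4) (s₂ := -1 / 5) (U₁ := 79 / 10) (U₂ := 8)
    (n₁ := 1 / 5) (n₂ := 1) (a := 5 / 32) (b := 27 / 32) (m := 0.0348) (by norm_num) (by norm_num) hβ0 (by norm_num) (by norm_num) (by norm_num)
    (by norm_num) (by norm_num) (by norm_num)
    (lsco78_capPlane_on_cell_of hVB (by norm_num) (by norm_num) (by norm_num))
    (fun s hs => lsco_n1_lawAt_of hK29 hK8 h21 h487 h427 h488 h472 h428 (U₀ := 79 / 10) (by norm_num) s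
      ⟨hs.1.trans' (by norm_num), hs.2.trans (by norm_num)⟩)
    (fun s hs => lsco_n1_law8_of hK8 h472 h428 s ⟨hs.1.trans' (by norm_num), hs.2.trans (by norm_num)⟩)
    (fun s hs U hU => lsco_dilute14_floor_right (n₁ := 1 / 5) (by norm_num) (by norm_num) s hs U (by linarith [hU.1]))
    ?_ ?_ (two_log_two_lt_mul_of_le (by norm_num) hβ (by norm_num)) hs hU h₁ h₂ hρ₁ hρ₁' hρ₂ hρ₂' hn0 hn2 hl0 hl1 hLs
  · intro s hs; obtain ⟨h1, h2⟩ := hs; push_cast; norm_num; nlinarith [h1, h2]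
  · intro s hs; obtain ⟨h1, h2⟩ := hs; push_cast; norm_num; nlinarith [h1, h2]

/-- **Right `t′`-half, `U ∈ [8, 81 / 10]`, `n₁ = 1 / 5`, `β ≥ 40`.** [cite: Israel1979, Thm. I.2.4] [cite: Griffiths1966, §II] -/
theorem lsco78_psT_1o5_beta40_right_above (hVB : cert_obx32x4tpm1o4D1200_openbox_32x4_N112_planes)
    (hK8 : cert_laBoxE_K2diag_GU8n1tpm3o10_j299783_up)
    (h472 : cert_r472_pb2_tl_upper_n1_U8) (h428 : cert_r428_hubSQ_hanK7R6_U8_r5_e4_so4blk)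
    {s : ℝ} (hs : s ∈ Icc (-1 / 4 : ℝ) (-1 / 5)) {U : ℝ} (hU : U ∈ Icc (8 : ℝ) (81 / 10))
    {β : ℝ} (hβ : (40 : ℝ) ≤ β)
    {ω₁ ω₂ : InfVolFermionState 2} (h₁ : ω₁.IsTranslationInvariant) (h₂ : ω₂.IsTranslationInvariant)
    (hρ₁ : 0 < ω₁.density) (hρ₁' : ω₁.density ≤ 1 / 5) (hρ₂ : 1 ≤ ω₂.density) (hρ₂' : ω₂.density < 2)
    {n : ℝ} (hn0 : 0 < n) (hn2 : n < 2) {lam : ℝ} (hl0 : 0 < lam) (hl1 : lam < 1) {Ls : ℕ → ℕ}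
    (hLs : Tendsto Ls atTop atTop) :
    ¬ (mix lam hl0.le hl1.le ω₁ ω₂).IsTorusLimitOfMixture (sectorGibbsCount n) (fun L => sectorGibbsWeightTT' β 1 s U n L)
      (fun L => sectorGibbsVectorTT' 1 s U n L) Ls := by
  have hβ0 : (0 : ℝ) < β := lt_of_lt_of_le (by norm_num) hβ
  refine psT_not_thermal_mix_above_column 1 (s₁ := -1 / 4) (s₂ := -1 / 5) (U₂ := 8) (U₃ := 81 / 10)
    (n₁ := 1 / 5) (n₂ := 1) (a := 5 / 32) (b := 27 / 32) (m := 0.0348) (by norm_num) (by norm_num) hβ0 (by norm_num) (by norm_num) (by norm_num)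
    (by norm_num) (by norm_num) (by norm_num)
    (lsco78_capPlane_on_cell_of hVB (by norm_num) (by norm_num) (by norm_num))
    (fun s hs => lsco_n1_law8_of hK8 h472 h428 s ⟨hs.1.trans' (by norm_num), hs.2.trans (by norm_num)⟩)
    (fun s hs U hU => lsco_dilute14_floor_right (n₁ := 1 / 5) (by norm_num) (by norm_num) s hs U (by linarith [hU.1]))
    ?_ (two_log_two_lt_mul_of_le (by norm_num) hβ (by norm_num)) hs hU h₁ h₂ hρ₁ hρ₁' hρ₂ hρ₂' hn0 hn2 hl0 hl1 hLs
  intro s hs; obtain ⟨h1, h2⟩ := hs; push_cast; norm_num; nlinarith [h1, h2]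

/-- **THE THERMAL `(≤ 1 / 5 | ≥ 1)` SENTENCE on `t′ ∈ [−3/10, −1/5] × U ∈ [79 / 10, 81 / 10]`, every `β ≥ 40`**: for every `(s, U)` of the cell and every canonical thermal torus-limit state of the `t–t′` model at `(β; 1, s, U; n)` (any `0 < n < 2`), the state is NOT a macroscopic mixture of a translation-invariant phase of density `0 < ρ(ω₁) ≤ 1 / 5` and one of density `1 ≤ ρ(ω₂) < 2`. [cite: Israel1979, Thm. I.2.4] [cite: EmeryKivelsonLin1990, pp. 475–476] -/
theorem lsco78_not_thermal_mix_le_1o5_ge_one_beta40 (hVB : cert_obx32x4tpm1o4D1200_openbox_32x4_N112_planes)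
    (hK29 : cert_laBoxE_K2diag_GU29o5n1tpm3o10_j295889_up) (hK8 : cert_laBoxE_K2diag_GU8n1tpm3o10_j299783_up)
    (h21 : cert_r21_luc_tl_upper_n1_U6) (h487 : cert_r487_hubSQ_hanK7R6_U10_r5_e4_so4blk)
    (h427 : cert_r427_hubSQ_hanK7_U5_r5_e4_so4blk) (h488 : cert_r488_hubSQ_hanK7R6_U6_r5_e4_so4blk)
    (h472 : cert_r472_pb2_tl_upper_n1_U8) (h428 : cert_r428_hubSQ_hanK7R6_U8_r5_e4_so4blk)
    {s : ℝ} (hs : s ∈ Icc (-3 / 10 : ℝ) (-1 / 5)) {U : ℝ} (hU : U ∈ Icc (79 / 10 : ℝ) (81 / 10))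
    {β : ℝ} (hβ : (40 : ℝ) ≤ β)
    {ω₁ ω₂ : InfVolFermionState 2} (h₁ : ω₁.IsTranslationInvariant) (h₂ : ω₂.IsTranslationInvariant)
    (hρ₁ : 0 < ω₁.density) (hρ₁' : ω₁.density ≤ 1 / 5) (hρ₂ : 1 ≤ ω₂.density) (hρ₂' : ω₂.density < 2)
    {n : ℝ} (hn0 : 0 < n) (hn2 : n < 2) {lam : ℝ} (hl0 : 0 < lam) (hl1 : lam < 1) {Ls : ℕ → ℕ}
    (hLs : Tendsto Ls atTop atTop) :
    ¬ (mix lam hl0.le hl1.le ω₁ ω₂).IsTorusLimitOfMixture (sectorGibbsCount n) (fun L => sectorGibbsWeightTT' β 1 s U n L)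
      (fun L => sectorGibbsVectorTT' 1 s U n L) Ls := by
  rcases le_total s (-1 / 4) with hsl | hsr
  · rcases le_total U 8 with hUl | hUr
    · exact lsco78_psT_1o5_beta40_left_columns hVB hK29 hK8 h21 h487 h427 h488 h472 h428 ⟨hs.1, hsl⟩ ⟨hU.1, hUl⟩ hβ h₁ h₂ hρ₁ hρ₁' hρ₂ hρ₂' hn0 hn2 hl0 hl1 hLs
    · exact lsco78_psT_1o5_beta40_left_above hVB hK8 h472 h428 ⟨hs.1, hsl⟩ ⟨hUr, hU.2⟩ hβ h₁ h₂ hρ₁ hρ₁' hρ₂ hρ₂' hn0 hn2 hl0 hl1 hLs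
  · rcases le_total U 8 with hUl | hUr
    · exact lsco78_psT_1o5_beta40_right_columns hVB hK29 hK8 h21 h487 h427 h488 h472 h428 ⟨hsr, hs.2⟩ ⟨hU.1, hUl⟩ hβ h₁ h₂ hρ₁ hρ₁' hρ₂ hρ₂' hn0 hn2 hl0 hl1 hLs
    · exact lsco78_psT_1o5_beta40_right_above hVB hK8 h472 h428 ⟨hsr, hs.2⟩ ⟨hUr, hU.2⟩ hβ h₁ h₂ hρ₁ hρ₁' hρ₂ hρ₂' hn0 hn2 hl0 hl1 hLs

/-! ## §2 `(≤ 1/4 | ≥ 1)` on `U ∈ [79/10, 81/10]`, every `β ≥ 77` -/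

/-- **Left `t′`-half, columns `[79 / 10, 8]`, `n₁ = 1 / 4`, `β ≥ 77`** (column margins `≥ 0.0182`). [cite: Israel1979, Thm. I.2.4] [cite: Ruelle1969, §3.3] -/
theorem lsco78_psT_1o4_beta77_left_columns (hVB : cert_obx32x4tpm1o4D1200_openbox_32x4_N112_planes)
    (hK29 : cert_laBoxE_K2diag_GU29o5n1tpm3o10_j295889_up) (hK8 : cert_laBoxE_K2diag_GU8n1tpm3o10_j299783_up)
    (h21 : cert_r21_luc_tl_upper_n1_U6) (h487 : cert_r487_hubSQ_hanK7R6_U10_r5_e4_so4blk)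
    (h427 : cert_r427_hubSQ_hanK7_U5_r5_e4_so4blk) (h488 : cert_r488_hubSQ_hanK7R6_U6_r5_e4_so4blk)
    (h472 : cert_r472_pb2_tl_upper_n1_U8) (h428 : cert_r428_hubSQ_hanK7R6_U8_r5_e4_so4blk)
    {s : ℝ} (hs : s ∈ Icc (-3 / 10 : ℝ) (-1 / 4)) {U : ℝ} (hU : U ∈ Icc (79 / 10 : ℝ) 8)
    {β : ℝ} (hβ : (77 : ℝ) ≤ β)
    {ω₁ ω₂ : InfVolFermionState 2} (h₁ : ω₁.IsTranslationInvariant) (h₂ : ω₂.IsTranslationInvariant)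
    (hρ₁ : 0 < ω₁.density) (hρ₁' : ω₁.density ≤ 1 / 4) (hρ₂ : 1 ≤ ω₂.density) (hρ₂' : ω₂.density < 2)
    {n : ℝ} (hn0 : 0 < n) (hn2 : n < 2) {lam : ℝ} (hl0 : 0 < lam) (hl1 : lam < 1) {Ls : ℕ → ℕ}
    (hLs : Tendsto Ls atTop atTop) :
    ¬ (mix lam hl0.le hl1.le ω₁ ω₂).IsTorusLimitOfMixture (sectorGibbsCount n) (fun L => sectorGibbsWeightTT' β 1 s U n L)
      (fun L => sectorGibbsVectorTT' 1 s U n L) Ls := by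
  have hβ0 : (0 : ℝ) < β := lt_of_lt_of_le (by norm_num) hβ
  refine psT_not_thermal_mix_on_cell_of_columns 1 (s₁ := -3 / 10) (s₂ := -1 / 4) (U₁ := 79 / 10) (U₂ := 8)
    (n₁ := 1 / 4) (n₂ := 1) (a := 1 / 6) (b := 5 / 6) (m := 0.0182) (by norm_num) (by norm_num) hβ0 (by norm_num) (by norm_num) (by norm_num)
    (by norm_num) (by norm_num) (by norm_num)
    (lsco78_capPlane_on_cell_of hVB (by norm_num) (by norm_num) (by norm_num))
    (fun s hs => lsco_n1_lawAt_of hK29 hK8 h21 h487 h427 h488 h472 h428 (U₀ := 79 / 10) (by norm_num) s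
      ⟨hs.1.trans' (by norm_num), hs.2.trans (by norm_num)⟩)
    (fun s hs => lsco_n1_law8_of hK8 h472 h428 s ⟨hs.1.trans' (by norm_num), hs.2.trans (by norm_num)⟩)
    (fun s hs U hU => lsco_dilute14_floor_left (n₁ := 1 / 4) (by norm_num) (by norm_num) s hs U (by linarith [hU.1]))
    ?_ ?_ (two_log_two_lt_mul_of_le (by norm_num) hβ (by norm_num)) hs hU h₁ h₂ hρ₁ hρ₁' hρ₂ hρ₂' hn0 hn2 hl0 hl1 hLs
  · intro s hs; obtain ⟨h1, h2⟩ := hs; push_cast; norm_num; nlinarith [h1, h2]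
  · intro s hs; obtain ⟨h1, h2⟩ := hs; push_cast; norm_num; nlinarith [h1, h2]

/-- **Left `t′`-half, `U ∈ [8, 81 / 10]`, `n₁ = 1 / 4`, `β ≥ 77`.** [cite: Israel1979, Thm. I.2.4] [cite: Griffiths1966, §II] -/
theorem lsco78_psT_1o4_beta77_left_above (hVB : cert_obx32x4tpm1o4D1200_openbox_32x4_N112_planes)
    (hK8 : cert_laBoxE_K2diag_GU8n1tpm3o10_j299783_up)
    (h472 : cert_r472_pb2_tl_upper_n1_U8) (h428 : cert_r428_hubSQ_hanK7R6_U8_r5_e4_so4blk)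
    {s : ℝ} (hs : s ∈ Icc (-3 / 10 : ℝ) (-1 / 4)) {U : ℝ} (hU : U ∈ Icc (8 : ℝ) (81 / 10))
    {β : ℝ} (hβ : (77 : ℝ) ≤ β)
    {ω₁ ω₂ : InfVolFermionState 2} (h₁ : ω₁.IsTranslationInvariant) (h₂ : ω₂.IsTranslationInvariant)
    (hρ₁ : 0 < ω₁.density) (hρ₁' : ω₁.density ≤ 1 / 4) (hρ₂ : 1 ≤ ω₂.density) (hρ₂' : ω₂.density < 2)
    {n : ℝ} (hn0 : 0 < n) (hn2 : n < 2) {lam : ℝ} (hl0 : 0 < lam) (hl1 : lam < 1) {Ls : ℕ → ℕ}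
    (hLs : Tendsto Ls atTop atTop) :
    ¬ (mix lam hl0.le hl1.le ω₁ ω₂).IsTorusLimitOfMixture (sectorGibbsCount n) (fun L => sectorGibbsWeightTT' β 1 s U n L)
      (fun L => sectorGibbsVectorTT' 1 s U n L) Ls := by
  have hβ0 : (0 : ℝ) < β := lt_of_lt_of_le (by norm_num) hβ
  refine psT_not_thermal_mix_above_column 1 (s₁ := -3 / 10) (s₂ := -1 / 4) (U₂ := 8) (U₃ := 81 / 10)
    (n₁ := 1 / 4) (n₂ := 1) (a := 1 / 6) (b := 5 / 6) (m := 0.0182) (by norm_num) (by norm_num) hβ0 (by norm_num) (by norm_num) (by norm_num)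
    (by norm_num) (by norm_num) (by norm_num)
    (lsco78_capPlane_on_cell_of hVB (by norm_num) (by norm_num) (by norm_num))
    (fun s hs => lsco_n1_law8_of hK8 h472 h428 s ⟨hs.1.trans' (by norm_num), hs.2.trans (by norm_num)⟩)
    (fun s hs U hU => lsco_dilute14_floor_left (n₁ := 1 / 4) (by norm_num) (by norm_num) s hs U (by linarith [hU.1]))
    ?_ (two_log_two_lt_mul_of_le (by norm_num) hβ (by norm_num)) hs hU h₁ h₂ hρ₁ hρ₁' hρ₂ hρ₂' hn0 hn2 hl0 hl1 hLs
  intro s hs; obtain ⟨h1, h2⟩ := hs; push_cast; norm_num; nlinarith [h1, h2]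

/-- **Right `t′`-half, columns `[79 / 10, 8]`, `n₁ = 1 / 4`, `β ≥ 77`.** [cite: Israel1979, Thm. I.2.4] [cite: Ruelle1969, §3.3] -/
theorem lsco78_psT_1o4_beta77_right_columns (hVB : cert_obx32x4tpm1o4D1200_openbox_32x4_N112_planes)
    (hK29 : cert_laBoxE_K2diag_GU29o5n1tpm3o10_j295889_up) (hK8 : cert_laBoxE_K2diag_GU8n1tpm3o10_j299783_up)
    (h21 : cert_r21_luc_tl_upper_n1_U6) (h487 : cert_r487_hubSQ_hanK7R6_U10_r5_e4_so4blk)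
    (h427 : cert_r427_hubSQ_hanK7_U5_r5_e4_so4blk) (h488 : cert_r488_hubSQ_hanK7R6_U6_r5_e4_so4blk)
    (h472 : cert_r472_pb2_tl_upper_n1_U8) (h428 : cert_r428_hubSQ_hanK7R6_U8_r5_e4_so4blk)
    {s : ℝ} (hs : s ∈ Icc (-1 / 4 : ℝ) (-1 / 5)) {U : ℝ} (hU : U ∈ Icc (79 / 10 : ℝ) 8)
    {β : ℝ} (hβ : (77 : ℝ) ≤ β)
    {ω₁ ω₂ : InfVolFermionState 2} (h₁ : ω₁.IsTranslationInvariant) (h₂ : ω₂.IsTranslationInvariant)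
    (hρ₁ : 0 < ω₁.density) (hρ₁' : ω₁.density ≤ 1 / 4) (hρ₂ : 1 ≤ ω₂.density) (hρ₂' : ω₂.density < 2)
    {n : ℝ} (hn0 : 0 < n) (hn2 : n < 2) {lam : ℝ} (hl0 : 0 < lam) (hl1 : lam < 1) {Ls : ℕ → ℕ}
    (hLs : Tendsto Ls atTop atTop) :
    ¬ (mix lam hl0.le hl1.le ω₁ ω₂).IsTorusLimitOfMixture (sectorGibbsCount n) (fun L => sectorGibbsWeightTT' β 1 s U n L)
      (fun L => sectorGibbsVectorTT' 1 s U n L) Ls := by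
  have hβ0 : (0 : ℝ) < β := lt_of_lt_of_le (by norm_num) hβ
  refine psT_not_thermal_mix_on_cell_of_columns 1 (s₁ := -1 / 4) (s₂ := -1 / 5) (U₁ := 79 / 10) (U₂ := 8)
    (n₁ := 1 / 4) (n₂ := 1) (a := 1 / 6) (b := 5 / 6) (m := 0.0182) (by norm_num) (by norm_num) hβ0 (by norm_num) (by norm_num) (by norm_num)
    (by norm_num) (by norm_num) (by norm_num)
    (lsco78_capPlane_on_cell_of hVB (by norm_num) (by norm_num) (by norm_num))
    (fun s hs => lsco_n1_lawAt_of hK29 hK8 h21 h487 h427 h488 h472 h428 (U₀ := 79 / 10) (by norm_num) s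
      ⟨hs.1.trans' (by norm_num), hs.2.trans (by norm_num)⟩)
    (fun s hs => lsco_n1_law8_of hK8 h472 h428 s ⟨hs.1.trans' (by norm_num), hs.2.trans (by norm_num)⟩)
    (fun s hs U hU => lsco_dilute14_floor_right (n₁ := 1 / 4) (by norm_num) (by norm_num) s hs U (by linarith [hU.1]))
    ?_ ?_ (two_log_two_lt_mul_of_le (by norm_num) hβ (by norm_num)) hs hU h₁ h₂ hρ₁ hρ₁' hρ₂ hρ₂' hn0 hn2 hl0 hl1 hLs
  · intro s hs; obtain ⟨h1, h2⟩ := hs; push_cast; norm_num; nlinarith [h1, h2]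
  · intro s hs; obtain ⟨h1, h2⟩ := hs; push_cast; norm_num; nlinarith [h1, h2]

/-- **Right `t′`-half, `U ∈ [8, 81 / 10]`, `n₁ = 1 / 4`, `β ≥ 77`.** [cite: Israel1979, Thm. I.2.4] [cite: Griffiths1966, §II] -/
theorem lsco78_psT_1o4_beta77_right_above (hVB : cert_obx32x4tpm1o4D1200_openbox_32x4_N112_planes)
    (hK8 : cert_laBoxE_K2diag_GU8n1tpm3o10_j299783_up)
    (h472 : cert_r472_pb2_tl_upper_n1_U8) (h428 : cert_r428_hubSQ_hanK7R6_U8_r5_e4_so4blk)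
    {s : ℝ} (hs : s ∈ Icc (-1 / 4 : ℝ) (-1 / 5)) {U : ℝ} (hU : U ∈ Icc (8 : ℝ) (81 / 10))
    {β : ℝ} (hβ : (77 : ℝ) ≤ β)
    {ω₁ ω₂ : InfVolFermionState 2} (h₁ : ω₁.IsTranslationInvariant) (h₂ : ω₂.IsTranslationInvariant)
    (hρ₁ : 0 < ω₁.density) (hρ₁' : ω₁.density ≤ 1 / 4) (hρ₂ : 1 ≤ ω₂.density) (hρ₂' : ω₂.density < 2)
    {n : ℝ} (hn0 : 0 < n) (hn2 : n < 2) {lam : ℝ} (hl0 : 0 < lam) (hl1 : lam < 1) {Ls : ℕ → ℕ}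
    (hLs : Tendsto Ls atTop atTop) :
    ¬ (mix lam hl0.le hl1.le ω₁ ω₂).IsTorusLimitOfMixture (sectorGibbsCount n) (fun L => sectorGibbsWeightTT' β 1 s U n L)
      (fun L => sectorGibbsVectorTT' 1 s U n L) Ls := by
  have hβ0 : (0 : ℝ) < β := lt_of_lt_of_le (by norm_num) hβ
  refine psT_not_thermal_mix_above_column 1 (s₁ := -1 / 4) (s₂ := -1 / 5) (U₂ := 8) (U₃ := 81 / 10)
    (n₁ := 1 / 4) (n₂ := 1) (a := 1 / 6) (b := 5 / 6) (m := 0.0182) (by norm_num) (by norm_num) hβ0 (by norm_num) (by norm_num) (by norm_num)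
    (by norm_num) (by norm_num) (by norm_num)
    (lsco78_capPlane_on_cell_of hVB (by norm_num) (by norm_num) (by norm_num))
    (fun s hs => lsco_n1_law8_of hK8 h472 h428 s ⟨hs.1.trans' (by norm_num), hs.2.trans (by norm_num)⟩)
    (fun s hs U hU => lsco_dilute14_floor_right (n₁ := 1 / 4) (by norm_num) (by norm_num) s hs U (by linarith [hU.1]))
    ?_ (two_log_two_lt_mul_of_le (by norm_num) hβ (by norm_num)) hs hU h₁ h₂ hρ₁ hρ₁' hρ₂ hρ₂' hn0 hn2 hl0 hl1 hLs
  intro s hs; obtain ⟨h1, h2⟩ := hs; push_cast; norm_num; nlinarith [h1, h2]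

/-- **THE THERMAL `(≤ 1 / 4 | ≥ 1)` SENTENCE on `t′ ∈ [−3/10, −1/5] × U ∈ [79 / 10, 81 / 10]`, every `β ≥ 77`**: for every `(s, U)` of the cell and every canonical thermal torus-limit state of the `t–t′` model at `(β; 1, s, U; n)` (any `0 < n < 2`), the state is NOT a macroscopic mixture of a translation-invariant phase of density `0 < ρ(ω₁) ≤ 1 / 4` and one of density `1 ≤ ρ(ω₂) < 2`. [cite: Israel1979, Thm. I.2.4] [cite: EmeryKivelsonLin1990, pp. 475–476] -/
theorem lsco78_not_thermal_mix_le_1o4_ge_one_beta77 (hVB : cert_obx32x4tpm1o4D1200_openbox_32x4_N112_planes)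
    (hK29 : cert_laBoxE_K2diag_GU29o5n1tpm3o10_j295889_up) (hK8 : cert_laBoxE_K2diag_GU8n1tpm3o10_j299783_up)
    (h21 : cert_r21_luc_tl_upper_n1_U6) (h487 : cert_r487_hubSQ_hanK7R6_U10_r5_e4_so4blk)
    (h427 : cert_r427_hubSQ_hanK7_U5_r5_e4_so4blk) (h488 : cert_r488_hubSQ_hanK7R6_U6_r5_e4_so4blk)
    (h472 : cert_r472_pb2_tl_upper_n1_U8) (h428 : cert_r428_hubSQ_hanK7R6_U8_r5_e4_so4blk)
    {s : ℝ} (hs : s ∈ Icc (-3 / 10 : ℝ) (-1 / 5)) {U : ℝ} (hU : U ∈ Icc (79 / 10 : ℝ) (81 / 10))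
    {β : ℝ} (hβ : (77 : ℝ) ≤ β)
    {ω₁ ω₂ : InfVolFermionState 2} (h₁ : ω₁.IsTranslationInvariant) (h₂ : ω₂.IsTranslationInvariant)
    (hρ₁ : 0 < ω₁.density) (hρ₁' : ω₁.density ≤ 1 / 4) (hρ₂ : 1 ≤ ω₂.density) (hρ₂' : ω₂.density < 2)
    {n : ℝ} (hn0 : 0 < n) (hn2 : n < 2) {lam : ℝ} (hl0 : 0 < lam) (hl1 : lam < 1) {Ls : ℕ → ℕ}
    (hLs : Tendsto Ls atTop atTop) :
    ¬ (mix lam hl0.le hl1.le ω₁ ω₂).IsTorusLimitOfMixture (sectorGibbsCount n) (fun L => sectorGibbsWeightTT' β 1 s U n L)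
      (fun L => sectorGibbsVectorTT' 1 s U n L) Ls := by
  rcases le_total s (-1 / 4) with hsl | hsr
  · rcases le_total U 8 with hUl | hUr
    · exact lsco78_psT_1o4_beta77_left_columns hVB hK29 hK8 h21 h487 h427 h488 h472 h428 ⟨hs.1, hsl⟩ ⟨hU.1, hUl⟩ hβ h₁ h₂ hρ₁ hρ₁' hρ₂ hρ₂' hn0 hn2 hl0 hl1 hLs
    · exact lsco78_psT_1o4_beta77_left_above hVB hK8 h472 h428 ⟨hs.1, hsl⟩ ⟨hUr, hU.2⟩ hβ h₁ h₂ hρ₁ hρ₁' hρ₂ hρ₂' hn0 hn2 hl0 hl1 hLs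
  · rcases le_total U 8 with hUl | hUr
    · exact lsco78_psT_1o4_beta77_right_columns hVB hK29 hK8 h21 h487 h427 h488 h472 h428 ⟨hsr, hs.2⟩ ⟨hU.1, hUl⟩ hβ h₁ h₂ hρ₁ hρ₁' hρ₂ hρ₂' hn0 hn2 hl0 hl1 hLs
    · exact lsco78_psT_1o4_beta77_right_above hVB hK8 h472 h428 ⟨hsr, hs.2⟩ ⟨hUr, hU.2⟩ hβ h₁ h₂ hρ₁ hρ₁' hρ₂ hρ₂' hn0 hn2 hl0 hl1 hLs

end Summit.Ventures.CertifiedManyBodySolver.Downfold
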